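import Literature.Topology.FourManifolds.SlideSetup2
import Literature.Topology.FourManifolds.SlideCurveGlue
import HarnessLib

/-!
# The slid circle in the slab, I: the lower track piece and its stub

Topic `Literature/Topology/FourManifolds`; fact seat `provefact-IsStrictHandleSlide.isSurgery`
(R. C. Kirby, *The Topology of 4-Manifolds*, LNM 1374 (1989), Ch. I §4, Fig. 4.2; remaining content:
the named fact (S) `Literature.Topology.FourManifolds.FramedLink.IsStrictHandleSlide.slideModel`).
Along the knot parameter of the lower track of the slid circle `K₂` the Cartesian height in the
twisted meridian chart is `Rlo.y` (`RouteMonotone`, `Rlo = routeHypLo`): strictly decreasing with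
negative derivative on `[t_D, t_L]` (`RouteHyp.deriv_y_neg`). Here we add the **stub** below the
tip: `Rlo.y` is `C^∞` at every parameter whose height lies in the window and whose slice angle is
short of the far point (`contDiffAt_routeY`), in particular at `t_D`; hence its derivative is
continuous there and stays negative on `[t_D - η, t_D]` for some `η > 0` (`exists_stub_lo`), and
`Rlo.y` is strictly decreasing with negative derivative on `[t_D - η, t_L]` (`stub_track_lo`).

## References

* R. C. Kirby, *The Topology of 4-Manifolds*, LNM 1374, Springer (1989), Ch. I §4. [Kirby1989]
-/

open scoped Topology ContDiff
open Set Real Filter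

noncomputable section

namespace Literature.Topology.FourManifolds

/-- Continuity of the derivative of a `C^n` function (`n ≠ 0`) at a point. [folklore] -/
theorem ContDiffAt.continuousAt_deriv_real {f : ℝ → ℝ} {x : ℝ} {n : WithTop ℕ∞} (hf : ContDiffAt ℝ n f x) (hn : n ≠ 0) :
    ContinuousAt (deriv f) x := by
  have h := hf.continuousAt_fderiv hn
  have : deriv f = fun y ↦ fderiv ℝ f y 1 := by ext y; rfl
  rw [this]
  exact h.clm_apply continuousAt_const

/-- **Smoothness of a route height in the twisted chart.** For a `RouteHyp R` of a track `d`: at a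
parameter `τ` with `d.H₁ τ` in the window `(w₁, w₂)` and slice angle `R.θ τ ∈ (-π, π)`, the height
`R.y` is `C^∞` at `τ`. [folklore] -/
theorem RouteHyp.contDiffAt_y {d : K2LiteData} (R : RouteHyp d) {τ : ℝ} (hH : d.H₁ τ ∈ Ioo R.w₁ R.w₂)
    (hθ : R.θ τ ∈ Ioo (-π) π) : ContDiffAt ℝ ∞ R.y τ := by
  have hHn : Ioo R.w₁ R.w₂ ∈ 𝓝 (d.H₁ τ) := Ioo_mem_nhds hH.1 hH.2
  have he : ContDiffAt ℝ ∞ (fun s ↦ R.e (d.H₁ s)) τ :=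
    (R.e_smooth.contDiffAt hHn).comp τ d.contDiff_H₁.contDiffAt
  have hΘ : ContDiffAt ℝ ∞ R.θ τ := by
    have : R.θ = fun s ↦ R.Θ (d.H₁ s) := rfl
    rw [this]; exact (R.Θ_smooth.contDiffAt hHn).comp τ d.contDiff_H₁.contDiffAt
  have hr : ContDiffAt ℝ ∞ R.r τ := by
    have : R.r = fun s ↦ 1 + (1 - d.X₁ s) * R.e (d.H₁ s) := rfl
    rw [this]; exact contDiffAt_const.add ((contDiffAt_const.sub d.contDiff_X₁.contDiffAt).mul he)
  have htw : ContDiffAt ℝ ∞ (fun p : ℝ × ℝ ↦ twistAngle R.c p.1 p.2) (R.r τ, R.θ τ) :=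
    (contDiffOn_twistAngle R.c).contDiffAt ((isOpen_univ.prod isOpen_Ioo).mem_nhds (Set.mk_mem_prod (mem_univ _) hθ))
  have hα' : ContDiffAt ℝ ∞ ((fun p : ℝ × ℝ ↦ twistAngle R.c p.1 p.2) ∘ fun s ↦ (R.r s, R.θ s)) τ :=
    htw.comp τ (hr.prodMk hΘ)
  have hα : ContDiffAt ℝ ∞ R.α τ := hα'
  have : R.y = fun s ↦ R.r s * sin (R.α s) := rfl
  rw [this]; exact hr.mul (contDiff_sin.contDiffAt.comp τ hα)

namespace BandCore

variable {A B : Knot} {avoid : Set (Metric.sphere (0 : EuclideanSpace ℝ (Fin 4)) 1)} {c : BandCore A B avoid}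

namespace SlideChoice

variable {e : ℝ → ℝ} (P : c.SlideChoice e) (he : ContDiffOn ℝ ∞ e (Ioo (10⁻¹ : ℝ) (9 / 10)))

/-- At the tip parameter the lower route height is `C^∞`. [folklore] -/
theorem contDiffAt_y_tD_lo : ContDiffAt ℝ ∞ (P.routeHypLo he).y P.dl.tD := by
  apply (P.routeHypLo he).contDiffAt_y
  · show P.dl.H₁ P.dl.tD ∈ Ioo (P.dl.hr0 - 2 * P.μ) (P.dl.hr1 + P.μ)
    have h := P.H₁_approach_lo ⟨le_rfl, P.dl.tD_lt_tL.le⟩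
    exact ⟨by linarith [h.1, P.μ_pos], by linarith [h.2, P.μ_pos]⟩
  · show (P.routeHypLo he).Θ (P.dl.H₁ P.dl.tD) ∈ Ioo (-π) π
    rw [RouteHyp.H₁_tD (d := P.dl)]
    show P.Θlo (P.dl.Hh P.dl.tD) ∈ Ioo (-π) π
    have : P.dl.Hh P.dl.tD = P.hD := rfl
    rw [this, P.Θlo_hD]
    have h := P.θD_mem; have := c.θlow_pos
    exact ⟨by linarith [h.1, pi_pos], by linarith [h.2]⟩

/-- **The stub below the lower tip**: for some `η > 0` the lower route height has negative
derivative on `[t_D - η, t_D]`. [cite: Kirby1989, Ch. I §4] -/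
theorem exists_stub_lo : ∃ η > 0, ∀ τ ∈ Icc (P.dl.tD - η) P.dl.tD,
    HasDerivAt (P.routeHypLo he).y (deriv (P.routeHypLo he).y τ) τ ∧ deriv (P.routeHypLo he).y τ < 0 := by
  set R := P.routeHypLo he
  have hcd := P.contDiffAt_y_tD_lo he
  have hneg : deriv R.y P.dl.tD < 0 := R.deriv_y_neg ⟨le_rfl, P.dl.tD_lt_tL.le⟩
  -- continuity of the derivative and differentiability near `t_D`
  have hcont : ContinuousAt (deriv R.y) P.dl.tD := ContDiffAt.continuousAt_deriv_real hcd (by simp)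
  have hev1 : ∀ᶠ τ in 𝓝 P.dl.tD, deriv R.y τ < 0 := hcont.eventually (gt_mem_nhds hneg)
  have hev2 : ∀ᶠ τ in 𝓝 P.dl.tD, DifferentiableAt ℝ R.y τ := by
    have h2 : ContDiffAt ℝ 2 R.y P.dl.tD := hcd.of_le (WithTop.coe_le_coe.2 le_top)
    have h := h2.eventually (by simp)
    exact h.mono fun τ hτ ↦ hτ.differentiableAt (by simp)
  obtain ⟨η, hη, hball⟩ := Metric.eventually_nhds_iff.1 (hev1.and hev2)
  refine ⟨η / 2, by positivity, fun τ hτ ↦ ?_⟩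
  have hτb : dist τ P.dl.tD < η := by
    rw [Real.dist_eq, abs_lt]; constructor <;> linarith [hτ.1, hτ.2]
  obtain ⟨h1, h2⟩ := hball hτb
  exact ⟨h2.hasDerivAt, h1⟩

/-- **The lower track with its stub**: for some `η > 0`, on `[t_D - η, t_L]` the lower route height
has negative derivative everywhere and is strictly decreasing. [cite: Kirby1989, Ch. I §4] -/
theorem stub_track_lo : ∃ η > 0, (∀ τ ∈ Icc (P.dl.tD - η) P.dl.tL,
    HasDerivAt (P.routeHypLo he).y (deriv (P.routeHypLo he).y τ) τ ∧ deriv (P.routeHypLo he).y τ < 0) ∧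
    StrictAntiOn (P.routeHypLo he).y (Icc (P.dl.tD - η) P.dl.tL) := by
  set R := P.routeHypLo he
  obtain ⟨η, hη, hstub⟩ := P.exists_stub_lo he
  have hd : ∀ τ ∈ Icc (P.dl.tD - η) P.dl.tL, HasDerivAt R.y (deriv R.y τ) τ ∧ deriv R.y τ < 0 := by
    intro τ hτ
    rcases le_total τ P.dl.tD with h | h
    · exact hstub τ ⟨hτ.1, h⟩
    · exact ⟨(R.hasDerivAt_y ⟨h, hτ.2⟩).differentiableAt.hasDerivAt, R.deriv_y_neg ⟨h, hτ.2⟩⟩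
  refine ⟨η, hη, hd, ?_⟩
  exact (strictAntiOn_of_local_pieces fun s hs ↦ ⟨R.y, deriv R.y s, EventuallyEq.rfl, hd s hs⟩).2

end SlideChoice

end BandCore

end Literature.Topology.FourManifolds
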